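/-
Copyright: cell `pub-ymgap` (HUMAN RULING D-0062), Track A of `YM-PLAN.md`, DAG node N20 (= NE7b); R134 acceleration seat
`pub-ymgap-dag-n20-c` (strategy s1, generation 9), module 46.  Released under the licence of the surrounding project.
-/
import Summits.QuantumFields.YangMills.Theorems.BalabanUVNodesN20LCSLabelTowerAtResidualOfRecord
import Summits.QuantumFields.YangMills.Theorems.BalabanUVNodesN20ChiSemantics
import Summits.QuantumFields.YangMills.Theorems.BalabanUVNodesN21ThresholdMixtureRStepLocalityRaw
import HarnessLib

/-!
# YM-DAG node N20 (= NE7b), row s1, module 46: THE PINNED LARGE-FIELD EVENT OF RECORD, READ AT THE RAW LETTERS — a pinned cube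
# certifies SOLVABILITY of its (2.16) problem, hence REGULARITY of the new field near it and FLATNESS far from it; the lineage's
# regularity letter `hreg` is EXACTLY «irregular selected minimiser ⇒ irregular datum» given solvability

Track A of `YM-PLAN.md` (cell `pub-ymgap`, HUMAN RULING D-0062), node **N20** = spine estimate NE7b (`T4WeightBudget.RelWeightBound`, NOT
PRINTED, NOT PROVED).  Seat `pub-ymgap-dag-n20-c` (R134, s1), generation 9, module 46.  Kernel theorems only: 0 `def`, 0 `sorry`, standard
axioms; COUNT-NEUTRAL.  Composition BY NAME of module 34 (`…N20LCSLabelTowerAtResidualOfRecord`: support semantics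
`chiFactor_of_eterm_ne_zero_rec`), dag-n20-d's `…N20ChiSemantics` (the (2.16) problem of record is solvable only at locally regular data; junk
off the solvable set) and dag-n21-e's `…N21ThresholdMixtureRStepLocalityRaw` (a far large plaquette of the datum empties the solvable set; the
block-corner identity `(Q_k^{s*}V)(∂p) = V(∂P)`).  Nothing is re-declared.

THE QUESTION.  Modules 17–45 of this lineage extract the Peierls factor of a PINNED large-field cube `c ∈ P_{k+1}` through ONE displayed letter,
`hreg : (∀ p′ ∈ R c, |V′(∂p′) − 1| < ε″) → χ_{k+1}(c)(V′) = 1` ([Balaban1985Variational] Thm 1 shape), read contrapositively on the support of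
the history term (module 38 §1: `χ_{k+1}(c)(V′) = 0` there ⇒ a plaquette of `V′` on `R c` is `ε″`-large).  WHAT DOES THE EVENT `χ_{k+1}(c)(V′) = 0`
SAY BY ITSELF at the record's raw letters (def-R's `chiFactor`: the small-field test of the LOCAL background (2.16)
`U_{k+1,□}(V′) = U(𝐁_{k+1}(□^{∼4}), M˙(Q_{k+1}^{s*}V′))` of the TOTALISED (2.12) solution map `Node00.UminOfRecord` over the GLOBAL class
`{U | PlaqSmall (εreg·η_{k+1}²) U}`, unit configuration off the solvable set — director-ym disposition H0 «the record's χ is RAW», bus l.19329)?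

WHAT THIS FILE PROVES.
* §1 **THE PINNED EVENT IS A SOLVABILITY EVENT.**  `χ_{k+1}(c)(V′) = 0 ↔ ¬ PlaqSmallOn {p ⊂ □^∼} (ε_{k+1}η²) (U_{k+1,□}(V′))`
  (`chiFactor_eq_zero_iff`); off the solvable set the factor is `1` (n20-d's junk lemma read at `chiFactor`: `chiFactor_eq_one_of_not_solvable`),
  so **`χ_{k+1}(c)(V′) = 0 ⇒ the (2.16) problem of record at `c` is SOLVABLE at `V′`** (`solvable_of_chiFactor_eq_zero`) and the selected
  background is a genuine minimiser, `εreg·η²`-regular on the WHOLE fine torus yet NOT `ε_{k+1}η²`-regular on `{p ⊂ □^∼}` — whence the thresholds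
  are forced non-degenerate: `ε_{k+1} < εreg` (`epsOfRecord_lt_of_chiFactor_eq_zero`; module 24's sanity, contrapositive).
* §2 **WHAT SOLVABILITY SAYS ABOUT THE DATUM `V′`.**  NEAR `c`: `|V′(∂q) − 1| < 2εreg` for every level-`(k+1)` plaquette `q` cornered in the
  top-scale constraint region `pts (k+1) (maxDomT M₁ □^{∼4} (k+1))` (n20-d §2 `dist1_plaqHol_lt_of_solvable`: the minimiser averages to `V′`
  there, [Balaban1988Convergent] p. 267 l. 5–7, and averaging preserves regularity, [Balaban1985Averaging] Prop. 2) —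
  `dist1_lt_near_of_chiFactor_eq_zero`.  FAR from `c`: `|V′(∂P) − 1| < εreg·η_{k+1}²` for every level-`(k+1)` plaquette `P` whose fine corner
  plaquette has its four bonds among the `Γ₀`-bonds of `𝐁_{k+1}(□^{∼4})` (n21-e's far-junk-1, contrapositive: a far large plaquette empties
  the solvable set) — `dist1_lt_far_of_chiFactor_eq_zero`, and its scale-`0` form for any far fine plaquette of the datum `Q_{k+1}^{s*}V′`.
* §3 **ON THE SUPPORT OF A HISTORY TERM OF BAŁABAN's LABEL TOWER AT THE RESIDUAL OF RECORD** (`labelTowerOfRecord A₁ (zeta316OfRecord A₁)`):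
  for a history `h : Fin (k+1) → LabelPat` and a cube `c` of its last label's (3.2) family, wherever `eterm ρ₀ (k+1) h V′ ≠ 0`: the problem at
  `c` is solvable at `V′` (`solvable_of_eterm_ne_zero`), `ε_{k+1} < εreg` (`epsOfRecord_lt_of_eterm_ne_zero`: a term with a non-empty pinned
  family VANISHES IDENTICALLY in the degenerate threshold regime — `eterm_eq_zero_of_le_epsOfRecord`), `V′` is `2εreg`-regular near `c` and
  `εreg·η²`-flat far from `c` (`dist1_lt_near_of_eterm_ne_zero`, `dist1_lt_far_of_eterm_ne_zero`).
* §4 ★★★ **`hreg` ISOLATED TO ITS CONTENT** (`hreg_iff_minimiser_form`): for every cube `c`, region `R` and threshold `ε″`, the lineage's letter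
  `∀ V′, (∀ p′ ∈ R, |V′(∂p′) − 1| < ε″) → χ_{k+1}(c)(V′) = 1` is EQUIVALENT to
  `∀ V′, solvable_c(V′) → ¬ PlaqSmallOn {p ⊂ □^∼} (ε_{k+1}η²) (U_{k+1,□}(V′)) → ∃ p′ ∈ R, ε″ ≤ |V′(∂p′) − 1|` — «an IRREGULAR SELECTED MINIMISER of
  the (2.12) problem of record forces an irregular DATUM on `R`», i.e. the contrapositive of [Balaban1985Variational] Thm 1's interior regularity
  (9) for the problem of record GIVEN SOLVABILITY, and nothing else (existence is not asked: off the solvable set the letter holds by junk;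
  uniqueness is not asked: the letter speaks of the selected minimiser).  Corollary (`hreg_of_regularity`): ANY interior-regularity statement
  «every minimiser of the problem of record at data `ε″`-small on `R` is `ε_{k+1}η²`-small on `{p ⊂ □^∼}`» implies `hreg`.

WHAT THIS MEANS FOR N20 (located, honest).  At the record's raw letters a pinned LARGE-field cube certifies that the new field is `2εreg`-REGULAR
next to it and `εreg·η_{k+1}²`-FLAT away from it; LARGENESS of `V′` anywhere — the only thing a Chebyshev split can cash (modules 18–23, 39–41) —
enters EXCLUSIVELY through `hreg`, which §4 shows to be [Balaban1985Variational] Thm 1 (9) for the LOCAL problem of record given solvability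
(K0's pen; the tree's Theorem-1 socket `B11Thm1CarrierT.varProblemT` is the NO-HOLES global problem).  The far-flatness face is RECORDED, NOT
EXPLOITED: a weight bound drawn from it would be an artefact of the totalisation (VACUOUS w.r.t. print, where the far cube carries its own
`χ = 0` and the 𝐑-operation), not an estimate of Bałaban's.

HONEST FRAMING.  By-name bookkeeping over def-R ∕ def-T ∕ r11 ∕ r12 letters and three landed modules; nothing of Bałaban's asserted
([Balaban1985Variational] Thm 1 is NOT asserted — it is the content `hreg` displays); NE7b NOT PRINTED ∕ NOT PROVED; (α)-instance 0∕1; N20 NOT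
discharged; typed 28∕28, discharged count untouched; one finite four-torus at fixed `ε` — NOT ℝ⁴, NOT infinite volume, NOT OS, NOT a mass gap,
NOT Clay.

References (LOCATORS): T. Bałaban, CMP 119 (1988) 243–285 [Balaban1988Convergent] ((2.12)–(2.13) p.256–257, (2.16)–(2.17) p.257, (3.2) p.265,
p.267 l.5–7); CMP 98 (1985) 17–51 [Balaban1985Averaging] (Prop. 2 p.26); CMP 102 (1985) 277–309 [Balaban1985Variational] (Thm 1 (9) p.279).
-/

set_option autoImplicit false

noncomputable section

open scoped BigOperators

namespace Summit.QuantumFields.YangMills.BalabanUVNodes.N20LCSPinnedEventRaw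

open MeasureTheory
open Literature.MathematicalPhysics.QuantumFieldTheory.Balaban1983to89
open Literature.MathematicalPhysics.QuantumFieldTheory.Balaban1983to89.T4Continuum
open Literature.MathematicalPhysics.QuantumFieldTheory.Balaban1983to89.B14.Eq218Concrete
open Literature.MathematicalPhysics.QuantumFieldTheory.Balaban1983to89.Node00
open B15DeterminingSets B14.Eq213DetSet B14.Eq216Concrete B14.Eq213MaximalDomains B15Eq112TorusCover B14DomainGeom
open B14.Eq12InteriorLocality (plaqBonds extBonds)
open Literature.MathematicalPhysics.QuantumFieldTheory.BalabanImbrieJaffe1984to88.BIJ85Eq453GaugeField (qsstarGIter0)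
open ExpMeanLog (deltaSU)
open Summit.QuantumFields.YangMills.BalabanUVNodes.N20LCSLabelTower
open Summit.QuantumFields.YangMills.BalabanUVNodes.N20LCSLabelTowerAtResidualOfRecord (chiFactor_of_eterm_ne_zero_rec)
open Summit.QuantumFields.YangMills.BalabanUVNodes.N20ChiSemantics
  (chiSmall_ukBox_eq_one_of_not_solvable dist1_plaqHol_lt_of_solvable plaqSmall_ukBox_of_solvable plaqHol_const_one
    isMinimizer_ukBox_of_solvable)
open Summit.QuantumFields.YangMills.Theorems.N21ThresholdMixtureRStepLocalityRaw
  (ukBox_bgOfRecord_eq_one_of_farLarge ukBox_bgOfRecord_eq_one_of_farLargeCoarse)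

variable (F : T4Family) (N : ℕ) [NeZero N] (ν : Stage7Numerics) (M : ℕ) (p : B12.RunParams) (g : ℕ → ℝ)

/-! ## §1 The pinned event of record is a solvability event -/

section Solvability

variable (k : ℕ) (c : Iχ F ν p g k) (V' : GaugeField (F.P p.K) (k + 1) (SU N))

/-- Unfolding def-T's (3.2) factor of record: the small-field test of the local background (2.16) on `{p ⊂ □^∼}` at threshold `ε_{k+1}η_{k+1}²`.
[cite: Balaban1988Convergent, (3.2) p.265, (2.16)–(2.17) p.257] -/
theorem chiFactor_eq (k : ℕ) (c : Iχ F ν p g k) (V' : GaugeField (F.P p.K) (k + 1) (SU N)) :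
    chiFactor F N ν p g k c V' =
      chiSmall (plaqInside (cubeEnl (F.P p.K) (sideχ F ν p g k) c 1)) (epsOfRecord ν g (k + 1) * (F.P p.K).eta (k + 1) ^ 2)
        (ukBox (bgOfRecord (avOfRecord F N p.K) {U | PlaqSmall (ν.εreg * (F.P p.K).eta (k + 1) ^ 2) U}) ν.M₁
          (cubeEnl (F.P p.K) (sideχ F ν p g k) c 4) (k + 1) V') := rfl

/-- **`χ_{k+1}(c)(V′) = 0` IFF THE LOCAL BACKGROUND FAILS THE SMALL-FIELD TEST ON `{p ⊂ □^∼}`.** [cite: Balaban1988Convergent, (3.2) p.265] -/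
theorem chiFactor_eq_zero_iff :
    chiFactor F N ν p g k c V' = 0 ↔
      ¬ PlaqSmallOn (plaqInside (cubeEnl (F.P p.K) (sideχ F ν p g k) c 1)) (epsOfRecord ν g (k + 1) * (F.P p.K).eta (k + 1) ^ 2)
        (ukBox (bgOfRecord (avOfRecord F N p.K) {U | PlaqSmall (ν.εreg * (F.P p.K).eta (k + 1) ^ 2) U}) ν.M₁
          (cubeEnl (F.P p.K) (sideχ F ν p g k) c 4) (k + 1) V') := by
  rw [chiFactor_eq]
  unfold chiSmall
  split_ifs with h
  · simp only [one_ne_zero, h, not_true_eq_false]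
  · simp only [h, not_false_eq_true]

/-- **`χ_{k+1}(c)(V′) = 1` IFF THE LOCAL BACKGROUND PASSES THE SMALL-FIELD TEST ON `{p ⊂ □^∼}`.** [cite: Balaban1988Convergent, (3.2) p.265] -/
theorem chiFactor_eq_one_iff :
    chiFactor F N ν p g k c V' = 1 ↔
      PlaqSmallOn (plaqInside (cubeEnl (F.P p.K) (sideχ F ν p g k) c 1)) (epsOfRecord ν g (k + 1) * (F.P p.K).eta (k + 1) ^ 2)
        (ukBox (bgOfRecord (avOfRecord F N p.K) {U | PlaqSmall (ν.εreg * (F.P p.K).eta (k + 1) ^ 2) U}) ν.M₁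
          (cubeEnl (F.P p.K) (sideχ F ν p g k) c 4) (k + 1) V') := by
  rw [chiFactor_eq]
  unfold chiSmall
  split_ifs with h
  · simp only [h]
  · simp only [zero_ne_one, h]

/-- **OFF THE SOLVABLE SET `χ_{k+1}(c) = 1` BY JUNK** (n20-d's `chiSmall_ukBox_eq_one_of_not_solvable` read at def-T's `chiFactor`; positive
threshold `ε_{k+1}η² > 0`). [cite: Balaban1988Convergent, (2.17) p.257 (typing convention)] -/
theorem chiFactor_eq_one_of_not_solvable (hε : 0 < epsOfRecord ν g (k + 1) * (F.P p.K).eta (k + 1) ^ 2)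
    (h : ¬ ∃ U₀, IsMinimizer (avOfRecord F N p.K) {U | PlaqSmall (ν.εreg * (F.P p.K).eta (k + 1) ^ 2) U}
      (Bj ν.M₁ (cubeEnl (F.P p.K) (sideχ F ν p g k) c 4) (k + 1)) (avgFamily (avOfRecord F N p.K) (qsstarGIter0 (k + 1) V')) U₀) :
    chiFactor F N ν p g k c V' = 1 := by
  rw [chiFactor_eq]
  exact chiSmall_ukBox_eq_one_of_not_solvable _ hε h

/-- ★ **A PINNED CUBE CERTIFIES SOLVABILITY**: `χ_{k+1}(c)(V′) = 0` ⇒ the (2.16) problem of record at `c` — determining set `𝐁_{k+1}(□^{∼4})`, datum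
`M˙(Q_{k+1}^{s*}V′)`, class `{U | PlaqSmall (εreg·η_{k+1}²) U}` — is SOLVABLE at `V′`. [cite: Balaban1988Convergent, (2.12) p.256, (2.16) p.257] -/
theorem solvable_of_chiFactor_eq_zero (hε : 0 < epsOfRecord ν g (k + 1) * (F.P p.K).eta (k + 1) ^ 2)
    (h0 : chiFactor F N ν p g k c V' = 0) :
    ∃ U₀, IsMinimizer (avOfRecord F N p.K) {U | PlaqSmall (ν.εreg * (F.P p.K).eta (k + 1) ^ 2) U}
      (Bj ν.M₁ (cubeEnl (F.P p.K) (sideχ F ν p g k) c 4) (k + 1)) (avgFamily (avOfRecord F N p.K) (qsstarGIter0 (k + 1) V')) U₀ := by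
  by_contra h
  rw [chiFactor_eq_one_of_not_solvable F N ν p g k c V' hε h] at h0
  exact one_ne_zero h0

/-- … hence the local background is a minimiser of the problem of record, `εreg·η_{k+1}²`-regular on the WHOLE fine torus (membership in the
class). [cite: Balaban1988Convergent, (2.12) p.256] -/
theorem plaqSmall_ukBox_of_chiFactor_eq_zero (hε : 0 < epsOfRecord ν g (k + 1) * (F.P p.K).eta (k + 1) ^ 2)
    (h0 : chiFactor F N ν p g k c V' = 0) :
    PlaqSmall (ν.εreg * (F.P p.K).eta (k + 1) ^ 2)
      (ukBox (bgOfRecord (avOfRecord F N p.K) {U | PlaqSmall (ν.εreg * (F.P p.K).eta (k + 1) ^ 2) U}) ν.M₁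
        (cubeEnl (F.P p.K) (sideχ F ν p g k) c 4) (k + 1) V') :=
  plaqSmall_ukBox_of_solvable (solvable_of_chiFactor_eq_zero F N ν p g k c V' hε h0)

/-- ★ **THE THRESHOLDS ARE FORCED NON-DEGENERATE**: `χ_{k+1}(c)(V′) = 0` ⇒ `ε_{k+1} < εreg` (the selected background is `εreg·η²`-regular everywhere
and fails the `ε_{k+1}η²`-test somewhere on `{p ⊂ □^∼}`; `η_{k+1}² > 0`) — module 24's sanity `chiFactor_eq_one_of_epsreg_le`, contrapositive.
[cite: Balaban1988Convergent, (2.4) p.255, (2.12) p.256] -/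
theorem epsOfRecord_lt_of_chiFactor_eq_zero (hε : 0 < epsOfRecord ν g (k + 1) * (F.P p.K).eta (k + 1) ^ 2)
    (h0 : chiFactor F N ν p g k c V' = 0) : epsOfRecord ν g (k + 1) < ν.εreg := by
  have hsm := plaqSmall_ukBox_of_chiFactor_eq_zero F N ν p g k c V' hε h0
  have hns := (chiFactor_eq_zero_iff F N ν p g k c V').1 h0
  unfold PlaqSmallOn at hns
  push Not at hns
  obtain ⟨q, -, hq⟩ := hns
  have hlt := lt_of_le_of_lt hq (hsm q)
  have hη : 0 < (F.P p.K).eta (k + 1) ^ 2 := by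
    have : 0 < (F.P p.K).eta (k + 1) := by
      unfold Params.eta
      exact pow_pos (inv_pos.2 (by exact_mod_cast (F.P p.K).L_pos)) _
    positivity
  exact lt_of_mul_lt_mul_right hlt hη.le

/-- In the DEGENERATE threshold regime `εreg ≤ ε_{k+1}` the pinned event is EMPTY: `χ_{k+1}(c) ≡ 1`. [cite: Balaban1988Convergent, (2.4) p.255, (3.2) p.265] -/
theorem chiFactor_eq_one_of_le_epsOfRecord (hε : 0 < epsOfRecord ν g (k + 1) * (F.P p.K).eta (k + 1) ^ 2)
    (hle : ν.εreg ≤ epsOfRecord ν g (k + 1)) : chiFactor F N ν p g k c V' = 1 := by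
  by_contra h1
  have h0 : chiFactor F N ν p g k c V' = 0 :=
    (chiFactor_eq_zero_iff F N ν p g k c V').2 (fun h => h1 ((chiFactor_eq_one_iff F N ν p g k c V').2 h))
  exact not_lt.2 hle (epsOfRecord_lt_of_chiFactor_eq_zero F N ν p g k c V' hε h0)

end Solvability

/-! ## §2 What solvability says about the datum: regular near the cube, flat far from it -/

section Datum

variable (k : ℕ) (c : Iχ F ν p g k) (V' : GaugeField (F.P p.K) (k + 1) (SU N))

/-- ★ **NEAR THE PINNED CUBE THE NEW FIELD IS `2εreg`-REGULAR**: `χ_{k+1}(c)(V′) = 0` ⇒ `|V′(∂q) − 1| < 2εreg` for every level-`(k+1)` plaquette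
`q` cornered in the top-scale constraint region `pts (k+1) (maxDomT M₁ □^{∼4} (k+1))` (n20-d's `dist1_plaqHol_lt_of_solvable` on the certified
solvable set; numeric side conditions of [Balaban1985Averaging] Prop. 2 on `εreg`, standing range `k + 1 ≤ m + K`).
[cite: Balaban1988Convergent, p.267; Balaban1985Averaging, Prop. 2 (52)–(54) p.26] -/
theorem dist1_lt_near_of_chiFactor_eq_zero (hk : k + 1 ≤ (F.P p.K).m + (F.P p.K).K)
    (hε : 0 < epsOfRecord ν g (k + 1) * (F.P p.K).eta (k + 1) ^ 2) (hreg0 : 0 < ν.εreg)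
    (hε3 : (143 * (((((F.P p.K).d + 4 : ℕ) : ℝ)) ^ 2 / 4) ^ 2) * ν.εreg ≤ 1 / 3)
    (hε2 : 2 * ν.εreg ≤ 2 * deltaSU (Fin N) / ((((F.P p.K).d + 4) * (F.P p.K).L : ℕ) : ℝ) ^ 2)
    (h0 : chiFactor F N ν p g k c V' = 0) (q : Plaq (F.P p.K) (k + 1))
    (hq₀ : q.src ∈ pts (k + 1) (maxDomT ν.M₁ (cubeEnl (F.P p.K) (sideχ F ν p g k) c 4) (k + 1)))
    (hqμ : q.src.shift q.μ ∈ pts (k + 1) (maxDomT ν.M₁ (cubeEnl (F.P p.K) (sideχ F ν p g k) c 4) (k + 1)))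
    (hqν : q.src.shift q.ν ∈ pts (k + 1) (maxDomT ν.M₁ (cubeEnl (F.P p.K) (sideχ F ν p g k) c 4) (k + 1))) :
    dist1 (GaugeField.plaqHol V' q) < 2 * ν.εreg :=
  dist1_plaqHol_lt_of_solvable hk hreg0 hε3 hε2 (solvable_of_chiFactor_eq_zero F N ν p g k c V' hε h0) q hq₀ hqμ hqν

/-- ★ **FAR FROM THE PINNED CUBE THE DATUM IS `εreg·η²`-FLAT (scale-0 form)**: `χ_{k+1}(c)(V′) = 0` ⇒ every fine plaquette `q` whose four bonds are
`Γ₀`-bonds of `𝐁_{k+1}(□^{∼4})` has `|(Q_{k+1}^{s*}V′)(∂q) − 1| < εreg·η_{k+1}²` (n21-e's far-junk-1, contrapositive).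
[cite: Balaban1988Convergent, (2.2) p.255, (2.12) p.256, (2.16) p.257] -/
theorem dist1_qsstar_lt_far_of_chiFactor_eq_zero (hε : 0 < epsOfRecord ν g (k + 1) * (F.P p.K).eta (k + 1) ^ 2)
    (h0 : chiFactor F N ν p g k c V' = 0) {q : Plaq (F.P p.K) 0}
    (hq : plaqBonds q ⊆ extBonds (Bj ν.M₁ (cubeEnl (F.P p.K) (sideχ F ν p g k) c 4) (k + 1))) :
    dist1 (GaugeField.plaqHol (qsstarGIter0 (k + 1) V') q) < ν.εreg * (F.P p.K).eta (k + 1) ^ 2 := by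
  by_contra hge
  rw [not_lt] at hge
  have h1 := ukBox_bgOfRecord_eq_one_of_farLarge (avOfRecord F N p.K) ν.M₁ hq hge
  have h2 : chiFactor F N ν p g k c V' = 1 := by
    rw [chiFactor_eq, h1]
    unfold chiSmall
    rw [if_pos]
    intro r _
    rw [plaqHol_const_one, GaugeGroup.dist1_one]
    exact hε
  rw [h0] at h2
  exact zero_ne_one h2

/-- ★ **FAR FROM THE PINNED CUBE THE NEW FIELD IS `εreg·η²`-FLAT (coarse form)**: `χ_{k+1}(c)(V′) = 0` ⇒ `|V′(∂P) − 1| < εreg·η_{k+1}²` for every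
level-`(k+1)` plaquette `P = ⟨B, μ, ν⟩` whose fine CORNER plaquette `q` (vertices in the blocks `B, B+e_μ, B+e_ν, B+e_μ+e_ν`) has its four bonds
among the `Γ₀`-bonds of `𝐁_{k+1}(□^{∼4})` (n21-e's `ukBox_bgOfRecord_eq_one_of_farLargeCoarse`, contrapositive; standing range `k + 1 ≤ m + K`).
[cite: Balaban1988Convergent, (1.3) p.246, (2.12) p.256, (2.16) p.257] -/
theorem dist1_lt_far_of_chiFactor_eq_zero (hk : k + 1 ≤ (F.P p.K).m + (F.P p.K).K)
    (hε : 0 < epsOfRecord ν g (k + 1) * (F.P p.K).eta (k + 1) ^ 2)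
    (h0 : chiFactor F N ν p g k c V' = 0) {q : Plaq (F.P p.K) 0}
    (hq : plaqBonds q ⊆ extBonds (Bj ν.M₁ (cubeEnl (F.P p.K) (sideχ F ν p g k) c 4) (k + 1))) {B : Site (F.P p.K) (k + 1)}
    (hB₀ : B14.Eq22Determines.blockIter (k + 1) q.src = B) (hBμ : B14.Eq22Determines.blockIter (k + 1) (q.src.shift q.μ) = B.shift q.μ)
    (hBν : B14.Eq22Determines.blockIter (k + 1) (q.src.shift q.ν) = B.shift q.ν)
    (hBμν : B14.Eq22Determines.blockIter (k + 1) ((q.src.shift q.μ).shift q.ν) = (B.shift q.μ).shift q.ν) :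
    dist1 (GaugeField.plaqHol V' ⟨B, q.μ, q.ν, q.hμν⟩) < ν.εreg * (F.P p.K).eta (k + 1) ^ 2 := by
  by_contra hge
  rw [not_lt] at hge
  have h1 := ukBox_bgOfRecord_eq_one_of_farLargeCoarse (avOfRecord F N p.K) ν.M₁ hk hq hB₀ hBμ hBν hBμν hge
  have h2 : chiFactor F N ν p g k c V' = 1 := by
    rw [chiFactor_eq, h1]
    unfold chiSmall
    rw [if_pos]
    intro r _
    rw [plaqHol_const_one, GaugeGroup.dist1_one]
    exact hε
  rw [h0] at h2
  exact zero_ne_one h2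

end Datum

/-! ## §3 On the support of a history term of the label tower at the residual of record -/

section Support

variable (A₁ : ℝ)

/-- ★ **A HISTORY TERM PINNING `c` LIVES ON THE SOLVABLE SET OF `c`**: if `c` belongs to the (3.2) family of the last label of `h` and the
level-`(k+1)` term does not vanish at `V′`, the (2.16) problem of record at `c` is solvable at `V′` (module 34's `χ_{k+1}(c)(V′) = 0` + §1).
[cite: Balaban1988Convergent, (3.2) p.265, (2.12) p.256] -/
theorem solvable_of_eterm_ne_zero (ρ₀ : cfgOfRecord F N p.K 0 → ℝ) (k : ℕ) (h : Fin (k + 1) → LabelPat F ν p g)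
    {c : Iχ F ν p g k} (hc : c ∈ (labelAt F ν p g k (h (Fin.last k))).1)
    (hε : 0 < epsOfRecord ν g (k + 1) * (F.P p.K).eta (k + 1) ^ 2) (V' : cfgOfRecord F N p.K (k + 1))
    (hne : (labelTowerOfRecord F N ν M p g A₁ (zeta316OfRecord F N ν M A₁)).eterm ρ₀ (k + 1) h V' ≠ 0) :
    ∃ U₀, IsMinimizer (avOfRecord F N p.K) {U | PlaqSmall (ν.εreg * (F.P p.K).eta (k + 1) ^ 2) U}
      (Bj ν.M₁ (cubeEnl (F.P p.K) (sideχ F ν p g k) c 4) (k + 1)) (avgFamily (avOfRecord F N p.K) (qsstarGIter0 (k + 1) V')) U₀ :=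
  solvable_of_chiFactor_eq_zero F N ν p g k c V' hε ((chiFactor_of_eterm_ne_zero_rec F N ν M p g A₁ ρ₀ k h V' hne).2.2 c hc)

/-- ★ **NON-DEGENERATE THRESHOLDS ON THE SUPPORT**: a term with a cube in its last (3.2) family can be non-zero only if `ε_{k+1} < εreg`.
[cite: Balaban1988Convergent, (2.4) p.255, (3.2) p.265] -/
theorem epsOfRecord_lt_of_eterm_ne_zero (ρ₀ : cfgOfRecord F N p.K 0 → ℝ) (k : ℕ) (h : Fin (k + 1) → LabelPat F ν p g)
    {c : Iχ F ν p g k} (hc : c ∈ (labelAt F ν p g k (h (Fin.last k))).1)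
    (hε : 0 < epsOfRecord ν g (k + 1) * (F.P p.K).eta (k + 1) ^ 2) (V' : cfgOfRecord F N p.K (k + 1))
    (hne : (labelTowerOfRecord F N ν M p g A₁ (zeta316OfRecord F N ν M A₁)).eterm ρ₀ (k + 1) h V' ≠ 0) :
    epsOfRecord ν g (k + 1) < ν.εreg :=
  epsOfRecord_lt_of_chiFactor_eq_zero F N ν p g k c V' hε ((chiFactor_of_eterm_ne_zero_rec F N ν M p g A₁ ρ₀ k h V' hne).2.2 c hc)

/-- … equivalently: IN THE DEGENERATE REGIME `εreg ≤ ε_{k+1}` EVERY TERM WITH A NON-EMPTY PINNED FAMILY VANISHES IDENTICALLY (the large-field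
sector of step `k+1` of the record is empty there). [cite: Balaban1988Convergent, (2.4) p.255, (3.2) p.265] -/
theorem eterm_eq_zero_of_le_epsOfRecord (ρ₀ : cfgOfRecord F N p.K 0 → ℝ) (k : ℕ) (h : Fin (k + 1) → LabelPat F ν p g)
    {c : Iχ F ν p g k} (hc : c ∈ (labelAt F ν p g k (h (Fin.last k))).1)
    (hε : 0 < epsOfRecord ν g (k + 1) * (F.P p.K).eta (k + 1) ^ 2) (hle : ν.εreg ≤ epsOfRecord ν g (k + 1))
    (V' : cfgOfRecord F N p.K (k + 1)) :
    (labelTowerOfRecord F N ν M p g A₁ (zeta316OfRecord F N ν M A₁)).eterm ρ₀ (k + 1) h V' = 0 := by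
  by_contra hne
  exact not_lt.2 hle (epsOfRecord_lt_of_eterm_ne_zero F N ν M p g A₁ ρ₀ k h hc hε V' hne)

/-- ★★ **ON THE SUPPORT OF A TERM PINNING `c`, THE NEW FIELD IS `2εreg`-REGULAR NEAR `c`** (every level-`(k+1)` plaquette cornered in the top-scale
constraint region of `□_c^{∼4}`). [cite: Balaban1988Convergent, p.267; Balaban1985Averaging, Prop. 2 (52)–(54) p.26] -/
theorem dist1_lt_near_of_eterm_ne_zero (ρ₀ : cfgOfRecord F N p.K 0 → ℝ) (k : ℕ) (hk : k + 1 ≤ (F.P p.K).m + (F.P p.K).K)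
    (h : Fin (k + 1) → LabelPat F ν p g) {c : Iχ F ν p g k} (hc : c ∈ (labelAt F ν p g k (h (Fin.last k))).1)
    (hε : 0 < epsOfRecord ν g (k + 1) * (F.P p.K).eta (k + 1) ^ 2) (hreg0 : 0 < ν.εreg)
    (hε3 : (143 * (((((F.P p.K).d + 4 : ℕ) : ℝ)) ^ 2 / 4) ^ 2) * ν.εreg ≤ 1 / 3)
    (hε2 : 2 * ν.εreg ≤ 2 * deltaSU (Fin N) / ((((F.P p.K).d + 4) * (F.P p.K).L : ℕ) : ℝ) ^ 2)
    (V' : cfgOfRecord F N p.K (k + 1))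
    (hne : (labelTowerOfRecord F N ν M p g A₁ (zeta316OfRecord F N ν M A₁)).eterm ρ₀ (k + 1) h V' ≠ 0) (q : Plaq (F.P p.K) (k + 1))
    (hq₀ : q.src ∈ pts (k + 1) (maxDomT ν.M₁ (cubeEnl (F.P p.K) (sideχ F ν p g k) c 4) (k + 1)))
    (hqμ : q.src.shift q.μ ∈ pts (k + 1) (maxDomT ν.M₁ (cubeEnl (F.P p.K) (sideχ F ν p g k) c 4) (k + 1)))
    (hqν : q.src.shift q.ν ∈ pts (k + 1) (maxDomT ν.M₁ (cubeEnl (F.P p.K) (sideχ F ν p g k) c 4) (k + 1))) :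
    dist1 (GaugeField.plaqHol V' q) < 2 * ν.εreg :=
  dist1_lt_near_of_chiFactor_eq_zero F N ν p g k c V' hk hε hreg0 hε3 hε2
    ((chiFactor_of_eterm_ne_zero_rec F N ν M p g A₁ ρ₀ k h V' hne).2.2 c hc) q hq₀ hqμ hqν

/-- ★★ **ON THE SUPPORT OF A TERM PINNING `c`, THE NEW FIELD IS `εreg·η_{k+1}²`-FLAT FAR FROM `c`** (every level-`(k+1)` plaquette whose fine corner
plaquette has its bonds among the `Γ₀`-bonds of `𝐁_{k+1}(□_c^{∼4})`). [cite: Balaban1988Convergent, (1.3) p.246, (2.12) p.256, (2.16) p.257] -/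
theorem dist1_lt_far_of_eterm_ne_zero (ρ₀ : cfgOfRecord F N p.K 0 → ℝ) (k : ℕ) (hk : k + 1 ≤ (F.P p.K).m + (F.P p.K).K)
    (h : Fin (k + 1) → LabelPat F ν p g) {c : Iχ F ν p g k} (hc : c ∈ (labelAt F ν p g k (h (Fin.last k))).1)
    (hε : 0 < epsOfRecord ν g (k + 1) * (F.P p.K).eta (k + 1) ^ 2) (V' : cfgOfRecord F N p.K (k + 1))
    (hne : (labelTowerOfRecord F N ν M p g A₁ (zeta316OfRecord F N ν M A₁)).eterm ρ₀ (k + 1) h V' ≠ 0) {q : Plaq (F.P p.K) 0}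
    (hq : plaqBonds q ⊆ extBonds (Bj ν.M₁ (cubeEnl (F.P p.K) (sideχ F ν p g k) c 4) (k + 1))) {B : Site (F.P p.K) (k + 1)}
    (hB₀ : B14.Eq22Determines.blockIter (k + 1) q.src = B) (hBμ : B14.Eq22Determines.blockIter (k + 1) (q.src.shift q.μ) = B.shift q.μ)
    (hBν : B14.Eq22Determines.blockIter (k + 1) (q.src.shift q.ν) = B.shift q.ν)
    (hBμν : B14.Eq22Determines.blockIter (k + 1) ((q.src.shift q.μ).shift q.ν) = (B.shift q.μ).shift q.ν) :
    dist1 (GaugeField.plaqHol V' ⟨B, q.μ, q.ν, q.hμν⟩) < ν.εreg * (F.P p.K).eta (k + 1) ^ 2 :=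
  dist1_lt_far_of_chiFactor_eq_zero F N ν p g k c V' hk hε ((chiFactor_of_eterm_ne_zero_rec F N ν M p g A₁ ρ₀ k h V' hne).2.2 c hc)
    hq hB₀ hBμ hBν hBμν

end Support

/-! ## §4 The regularity letter `hreg` isolated to its content -/

section Hreg

variable (k : ℕ) (c : Iχ F ν p g k)

/-- ★★★ **`hreg` ⇔ «IRREGULAR SELECTED MINIMISER ⇒ IRREGULAR DATUM», GIVEN SOLVABILITY.**  For every region `R` and threshold `ε″`, the lineage's
regularity letter (modules 18–45) is EQUIVALENT at the record's raw letters to: for every `V′` at which the (2.16) problem of record at `c` is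
solvable and the selected background fails the `ε_{k+1}η²`-test on `{p ⊂ □^∼}`, some plaquette of `V′` on `R` is `ε″`-large — the contrapositive of
[Balaban1985Variational] Thm 1's interior regularity (9) for the problem of record, given solvability (existence NOT asked: off the solvable set
the letter holds by junk, §1; uniqueness NOT asked: the letter speaks of the selected minimiser). [cite: Balaban1985Variational, Thm 1 (9) p.279; Balaban1988Convergent, (2.16)–(2.17) p.257] -/
theorem hreg_iff_minimiser_form (hε : 0 < epsOfRecord ν g (k + 1) * (F.P p.K).eta (k + 1) ^ 2)
    (R : Finset (Plaq (F.P p.K) (k + 1))) (ε'' : ℝ) :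
    (∀ V' : GaugeField (F.P p.K) (k + 1) (SU N),
        (∀ p' ∈ R, dist1 (GaugeField.plaqHol V' p') < ε'') → chiFactor F N ν p g k c V' = 1) ↔
      ∀ V' : GaugeField (F.P p.K) (k + 1) (SU N),
        (∃ U₀, IsMinimizer (avOfRecord F N p.K) {U | PlaqSmall (ν.εreg * (F.P p.K).eta (k + 1) ^ 2) U}
          (Bj ν.M₁ (cubeEnl (F.P p.K) (sideχ F ν p g k) c 4) (k + 1)) (avgFamily (avOfRecord F N p.K) (qsstarGIter0 (k + 1) V')) U₀) →
        ¬ PlaqSmallOn (plaqInside (cubeEnl (F.P p.K) (sideχ F ν p g k) c 1)) (epsOfRecord ν g (k + 1) * (F.P p.K).eta (k + 1) ^ 2)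
            (ukBox (bgOfRecord (avOfRecord F N p.K) {U | PlaqSmall (ν.εreg * (F.P p.K).eta (k + 1) ^ 2) U}) ν.M₁
              (cubeEnl (F.P p.K) (sideχ F ν p g k) c 4) (k + 1) V') →
        ∃ p' ∈ R, ε'' ≤ dist1 (GaugeField.plaqHol V' p') := by
  constructor
  · intro hreg V' _ hns
    by_contra hall
    push Not at hall
    have h1 := hreg V' hall
    rw [chiFactor_eq_one_iff] at h1
    exact hns h1
  · intro hmin V' hsmall
    by_contra hne1
    have h0 : chiFactor F N ν p g k c V' = 0 :=
      (chiFactor_eq_zero_iff F N ν p g k c V').2 (fun h => hne1 ((chiFactor_eq_one_iff F N ν p g k c V').2 h))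
    obtain ⟨p', hp', hle⟩ := hmin V' (solvable_of_chiFactor_eq_zero F N ν p g k c V' hε h0)
      ((chiFactor_eq_zero_iff F N ν p g k c V').1 h0)
    exact not_lt.2 hle (hsmall p' hp')

/-- ★ **ANY INTERIOR-REGULARITY STATEMENT FOR THE PROBLEM OF RECORD IMPLIES `hreg`**: if EVERY minimiser of the (2.16) problem of record at `c` whose
datum `V′` is `ε″`-small on `R` is `ε_{k+1}η²`-small on `{p ⊂ □^∼}` (the shape of [Balaban1985Variational] Thm 1 (9) for the local problem, quantified
over all minimisers — so neither the selector nor uniqueness enters), then the lineage's letter holds at `c`. [cite: Balaban1985Variational, Thm 1 (9) p.279] -/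
theorem hreg_of_regularity (hε : 0 < epsOfRecord ν g (k + 1) * (F.P p.K).eta (k + 1) ^ 2)
    (R : Finset (Plaq (F.P p.K) (k + 1))) (ε'' : ℝ)
    (hThm1 : ∀ (V' : GaugeField (F.P p.K) (k + 1) (SU N)) (U₀ : GaugeField (F.P p.K) 0 (SU N)),
      IsMinimizer (avOfRecord F N p.K) {U | PlaqSmall (ν.εreg * (F.P p.K).eta (k + 1) ^ 2) U}
          (Bj ν.M₁ (cubeEnl (F.P p.K) (sideχ F ν p g k) c 4) (k + 1)) (avgFamily (avOfRecord F N p.K) (qsstarGIter0 (k + 1) V')) U₀ →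
      (∀ p' ∈ R, dist1 (GaugeField.plaqHol V' p') < ε'') →
      PlaqSmallOn (plaqInside (cubeEnl (F.P p.K) (sideχ F ν p g k) c 1)) (epsOfRecord ν g (k + 1) * (F.P p.K).eta (k + 1) ^ 2) U₀) :
    ∀ V' : GaugeField (F.P p.K) (k + 1) (SU N),
      (∀ p' ∈ R, dist1 (GaugeField.plaqHol V' p') < ε'') → chiFactor F N ν p g k c V' = 1 := by
  rw [hreg_iff_minimiser_form F N ν p g k c hε R ε'']
  intro V' hsolv hns
  by_contra hall
  push Not at hall
  exact hns (hThm1 V' _ (isMinimizer_ukBox_of_solvable hsolv) hall)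

/-- The family form over a pinned family `D` with regions `R c` (the exact shape of the letter in modules 18–45).
[cite: Balaban1985Variational, Thm 1 (9) p.279] -/
theorem hreg_family_of_regularity (hε : 0 < epsOfRecord ν g (k + 1) * (F.P p.K).eta (k + 1) ^ 2)
    (D : Finset (Iχ F ν p g k)) (R : Iχ F ν p g k → Finset (Plaq (F.P p.K) (k + 1))) (ε'' : ℝ)
    (hThm1 : ∀ c ∈ D, ∀ (V' : GaugeField (F.P p.K) (k + 1) (SU N)) (U₀ : GaugeField (F.P p.K) 0 (SU N)),
      IsMinimizer (avOfRecord F N p.K) {U | PlaqSmall (ν.εreg * (F.P p.K).eta (k + 1) ^ 2) U}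
          (Bj ν.M₁ (cubeEnl (F.P p.K) (sideχ F ν p g k) c 4) (k + 1)) (avgFamily (avOfRecord F N p.K) (qsstarGIter0 (k + 1) V')) U₀ →
      (∀ p' ∈ R c, dist1 (GaugeField.plaqHol V' p') < ε'') →
      PlaqSmallOn (plaqInside (cubeEnl (F.P p.K) (sideχ F ν p g k) c 1)) (epsOfRecord ν g (k + 1) * (F.P p.K).eta (k + 1) ^ 2) U₀) :
    ∀ c ∈ D, ∀ V' : GaugeField (F.P p.K) (k + 1) (SU N),
      (∀ p' ∈ R c, dist1 (GaugeField.plaqHol V' p') < ε'') → chiFactor F N ν p g k c V' = 1 :=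
  fun c hc => hreg_of_regularity F N ν p g k c hε (R c) ε'' (hThm1 c hc)

end Hreg

end Summit.QuantumFields.YangMills.BalabanUVNodes.N20LCSPinnedEventRaw

end
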